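import Summits.Ventures.PercRepro.S1KillMixedCells
import Summits.Ventures.PercRepro.S1ChainCoNullCellsTP
import Summits.Ventures.PercRepro.S1CellNineThirteen
import Summits.Ventures.PercRepro.S1ChainCellTenEight

/-!
# PercRepro — THE CELL `(9, 8)` MODULO THREE CAP TABLES (p2, gen 26; SUBCLAIM-S1 §6.10)

The third cell of row `9`, and the first whose coloop-free line fails at `t = 0` already: the lever cap `79` (gb 8 17)
must come down to `70` for triangle-free cores, and to `68 / 65 / 63 / 60 / 55 / 50 / 43 / 36 / 29 / 22 / 16 / 9 / 2`
at `t = 1 … 13` (mixed kill consumer, `3 / 2 / 1` four-circuits at `t = 0, 1, 2`, margins `+194 … +139`; exact twin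
mining/p2/g26/caps98.py). The coloop cases need caps too: one coloop (`16` points) at `t ≥ 7`:
`81 / 80 / 74 / 68 / 61 / 55 / 49` (the lever cap `88` closes `t ≤ 6`); two coloops (`15` points) at `t = 13` only: `88`
(the lever cap `94` closes `t ≤ 12`); `c ≥ 3` is lossy. All three tables are the hypotheses:

* `capNineEight17`, `capNineEight16`, `capNineEight15` — the tables; `mkNineEight`, `m4NineEight`, `rrNineEight1`,
  `rrNineEight2` — the kills and chain lengths;
* **`c025_core_nine_eight_of_caps`** — `RLS` at `(9, 4)` on every `e`-free core of rank `9` with `17` points, provided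
  (P9,8,17), (P9,8,16), (P9,8,15) hold as stated.
Axioms: standard.
-/

open scoped Matroid

namespace PercRepro

namespace S1

open Set

variable {α : Type}

/-- The four-circuit cap of the coloop-free `17`-point lines of `(9, 8)` at triangle count `t`:
`70, 68, 65, 63, 60, 55, 50, 43, 36, 29, 22, 16, 9, 2` at `t = 0 … 13`. -/
def capNineEight17 (t : ℕ) : ℕ := [70, 68, 65, 63, 60, 55, 50, 43, 36, 29, 22, 16, 9, 2].getD t 2

/-- The four-circuit cap of the one-coloop `16`-point lines at triangle count `t`: the lever cap `88` for `t ≤ 6`,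
then `81, 80, 74, 68, 61, 55, 49` at `t = 7 … 13`. -/
def capNineEight16 (t : ℕ) : ℕ := [88, 88, 88, 88, 88, 88, 88, 81, 80, 74, 68, 61, 55, 49].getD t 49

/-- The four-circuit cap of the two-coloop `15`-point lines at triangle count `t`: the lever cap `94` for `t ≤ 12`,
then `88`. -/
def capNineEight15 (t : ℕ) : ℕ := if t ≤ 12 then 94 else 88

/-- The triangles in the kill at each `t` (coloop-free case): `t` itself up to `7`, then `7`. -/
def mkNineEight (t : ℕ) : ℕ := min t 7

/-- The four-circuits in the kill at each `t` (coloop-free case): `3, 2, 1` at `t = 0, 1, 2`, none beyond. -/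
def m4NineEight (t : ℕ) : ℕ := [3, 2, 1].getD t 0

/-- The chain length `r` at each `t = s₃` for one coloop. -/
def rrNineEight1 (t : ℕ) : ℕ := [0, 1, 2, 3, 3, 4, 5, 5, 6, 6, 6, 6, 6, 6].getD t 0

/-- The chain length `r` at each `t = s₃` for two coloops. -/
def rrNineEight2 (t : ℕ) : ℕ := [0, 1, 2, 3, 3, 4, 5, 5, 6, 6, 6, 7, 8, 8].getD t 0

/-- **THE CELL `(9, 8)` MODULO THREE CAP TABLES**: `RLS` at `(9, 4)` on every `e`-free core of rank `9` with `17`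
points, provided (P9,8,17): every coloop-free `e`-free matroid of nullity `8` with `17` points and `t` triangles has at
most `capNineEight17 t` four-circuits; (P9,8,16): with `16` points and `t ≥ 7` triangles, at most `capNineEight16 t`;
(P9,8,15): with `15` points and `13` triangles, at most `88`. -/
theorem c025_core_nine_eight_of_caps (M : Matroid α) [M.Finite] (hR : M.eRank = (9 : ℕ)) (hn : M.E.ncard = 17)
    (hfree : ∀ e ∈ M.E, ∃ A ⊆ M.E \ {e}, e ∉ M.closure A ∧ e ∉ M.closure ((M.E \ {e}) \ A))
    (hcap17 : ∀ (N : Matroid α) [N.Finite],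
      (∀ e ∈ N.E, ∃ A ⊆ N.E \ {e}, e ∉ N.closure A ∧ e ∉ N.closure ((N.E \ {e}) \ A)) →
      N.E.encard = N.eRank + ((8 : ℕ) : ℕ∞) → N.E.ncard = 17 → N.coloops = ∅ →
      ∀ t, {C : Set α | N.IsCircuit C ∧ C.ncard = 3}.ncard = t →
      {C : Set α | N.IsCircuit C ∧ C.ncard = 4}.ncard ≤ capNineEight17 t)
    (hcap16 : ∀ (N : Matroid α) [N.Finite],
      (∀ e ∈ N.E, ∃ A ⊆ N.E \ {e}, e ∉ N.closure A ∧ e ∉ N.closure ((N.E \ {e}) \ A)) →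
      N.E.encard = N.eRank + ((8 : ℕ) : ℕ∞) → N.E.ncard = 16 → N.coloops = ∅ →
      ∀ t, 7 ≤ t → {C : Set α | N.IsCircuit C ∧ C.ncard = 3}.ncard = t →
      {C : Set α | N.IsCircuit C ∧ C.ncard = 4}.ncard ≤ capNineEight16 t)
    (hcap15 : ∀ (N : Matroid α) [N.Finite],
      (∀ e ∈ N.E, ∃ A ⊆ N.E \ {e}, e ∉ N.closure A ∧ e ∉ N.closure ((N.E \ {e}) \ A)) →
      N.E.encard = N.eRank + ((8 : ℕ) : ℕ∞) → N.E.ncard = 15 → N.coloops = ∅ →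
      {C : Set α | N.IsCircuit C ∧ C.ncard = 3}.ncard = 13 →
      {C : Set α | N.IsCircuit C ∧ C.ncard = 4}.ncard ≤ 88) :
    ThmN.RLS M 9 4 := by
  rcases (show M.coloops.ncard = 0 ∨ M.coloops.ncard = 1 ∨ M.coloops.ncard = 2 ∨ 3 ≤ M.coloops.ncard by omega)
    with h | h | h | h
  · have hcol : M.coloops = ∅ := (Set.ncard_eq_zero (M.ground_finite.subset M.coloops_subset_ground)).1 h
    exact rls_of_kill_case_mixed_capT M (p := 9) (d := 8) hR hn hfree hcol (by norm_num) (by norm_num)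
      (P := 13) (S5 := 568) capNineEight17 (by decide) hcap17 (by decide) mkNineEight m4NineEight (by decide)
      (by decide +kernel) (by decide +kernel)
  · refine rls_of_ladder_case_chain_conull_capTP M (p := 8) (c := 1) (d := 8) (by norm_num) (by norm_num) hR hn hfree h
      (by norm_num) (by norm_num) (P := 13) (S5 := 583) capNineEight16 (by decide) ?_
      (by decide) rrNineEight1 (by decide) (by decide +kernel) (by decide +kernel) (by decide +kernel)
    intro N _ hNfree hNd hNn hNcol t ht
    rcases Nat.lt_or_ge t 7 with h7 | h7
    · have hg := gb_cap_eight 8 16 88 rfl (by decide) N hNfree hNd hNn hNcol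
      have hc : capNineEight16 t = 88 := by
        unfold capNineEight16
        interval_cases t <;> rfl
      rw [hc]; exact hg
    · exact hcap16 N hNfree hNd hNn hNcol t h7 ht
  · refine rls_of_ladder_case_chain_conull_capTP M (p := 7) (c := 2) (d := 8) (by norm_num) (by norm_num) hR hn hfree h
      (by norm_num) (by norm_num) (P := 13) (S5 := 601) capNineEight15 (by decide) ?_
      (by decide) rrNineEight2 (by decide) (by decide +kernel) (by decide +kernel) (by decide +kernel)
    intro N _ hNfree hNd hNn hNcol t ht
    unfold capNineEight15
    split_ifs with h12
    · exact gb_cap_eight 7 15 94 rfl (by decide) N hNfree hNd hNn hNcol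
    · have h13 : t = 13 := by
        have hP' : {C : Set α | N.IsCircuit C ∧ C.ncard = 3}.ncard ≤ 13 :=
          (TriangleCap.core_ncard_triangles_le_cq3 N hNfree hNd).trans (by decide)
        omega
      rw [← h13] at hcap15
      exact hcap15 N hNfree hNd hNn hNcol ht
  · exact rls_of_coloops_lossy M (p := 6) (c := 3) (hR.trans (by norm_num)) (by norm_num) h phiK_nine_four_le

end S1

end PercRepro
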